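import Summits.QuantumFields.BalabanUV.T4Continuum.Spine.NE1p.DressedBirthSuppliers
import Summits.QuantumFields.BalabanUV.T4Continuum.Spine.NE1p.DressedUniformConstants

/-!
# T⁴ programme, spine estimate NE1′ (node O3b/H2) — THE ABSORPTION DOOR'S AMPLITUDE FIXED POINT AND THE JOINT SOURCE WINDOW
# (own-initiative arithmetic supplier «S5b ∕ W5-C» of the NE1′ formalisation swarm: leaf L-B's (w5b) smallness × leaf L-S's (w6))

Cell `pub-balaban`, sub-cell `t4`, BINDER-OWNERS row NE1′ (owner lineage t4-ne1p-p1, skeleton `t4/skeletons/NE1p-t4-ne1p-p1.md`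
v1.1 §2 leaves L-B ∕ L-S); swarm unit `b2b-balaban-t4-ne1p-formalise-leaf-02` (INTENT journalled 2026-08-20T08:22:56Z; records
GAPS C-ne1pleaf02-2 INFO-1); tree target `Summits/QuantumFields/BalabanUV/T4Continuum/Spine/NE1p/`; ADDITIVE — imports the crew
rows S5 `DressedBirthSuppliers` (p212423) and S3 `DressedUniformConstants` (p212599) ONLY, modifies nothing.

WHY.  Row S5's live-family supplier `DressedBirthSuppliers.hbirth_of_absorbsFrom_live` concludes the field `BookingLeaves.hbirth`
from absorption births under the dressed gate, at the price of the K-FREE smallness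
  `β₀ + A·U.N₀·U.A₀·(1−U.ρ′)⁻¹ ≤ U.A₀`                                                    ((w5b)-smallness)
— the dressing size `β₀` plus the absorption constant `A` times the fan-out `N₀` of live older families times the geometric age
sum `(1−ρ′)⁻¹` of their classes must fit under the class amplitude `A₀`, which appears on BOTH sides.  Row S3's constructor
`DressedUniformConstants.uniformConstantsCell` takes `A₀` as a free input, constrained only by the source window
  `m·(N₀·A₀·(1−ρ′)⁻¹) ≤ 1 − s̄⁰`                                                          ((w6), `UniformConstants.hsmall`).
This file types, once, WHEN THE TWO ARE JOINTLY INHABITABLE: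
* §1 the fan-out number `fanout A N₀ ρ′ = A·N₀·(1−ρ′)⁻¹` and the NECESSITY `fanout_lt_one_of_absorbSmall`: if `β₀ > 0` and some
  `A₀ ≥ 0` satisfies the (w5b)-smallness then `fanout A N₀ ρ′ < 1` — the synthesis wall's falsifier W5-C («c′·v·N₀(1−ρ′)⁻¹ < 1»,
  `t4/ideate/NE1p-WALL.md` §1 (w5)) as a kernel fact: if the absorption constant times the collared fan-out times the age sum
  reaches 1, NO amplitude closes the absorption door;
* §2 the SUFFICIENCY: the fixed point `absorbAmplitude β₀ A N₀ ρ′ = β₀ ∕ (1 − fanout A N₀ ρ′)` is the least admissible amplitude —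
  `absorbSmall_iff` (`(w5b)-smallness ⟺ absorbAmplitude ≤ A₀` when `fanout < 1`), `absorbSmall_absorbAmplitude` (equality case);
* §3 the JOINT WINDOW: with a dressing size `β₀ = b₁·μ₀` proportional to the source strength, `absorbAmplitude = a₁·μ₀` with
  `a₁ = b₁ ∕ (1 − fanout)` (`absorbAmplitude_linear`), so S3's `hsmall_of_le_muWindow` applies VERBATIM: (w6) ∧ (w5b)-smallness
  hold together for every `0 ≤ μ₀ ≤ muWindow s̄⁰ ρ′ m N₀ a₁` (`jointWindow`);
* §4 the COMPOSED SUPPLIER `hbirth_of_absorbsFrom_live_cell`: S5's live-family supplier at `U := uniformConstantsCell …` (S3) with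
  its `hsmall` DISCHARGED from `fanout (…) < 1 ∧ absorbAmplitude ≤ A₀` — conclusion VERBATIM the field type of `BookingLeaves.hbirth`;
* §5 decided numerals: the joint region is non-empty (`A = 1∕4`, `N₀ = 1`, `ρ′ = 1∕2` ⇒ `fanout = 1∕2`, `absorbAmplitude 1 … = 2`) —
  non-vacuity of the arithmetic, NOT a claim about Bałaban's constants.

HONEST FRAMING.  [folklore] real arithmetic over DISPLAYED binders: `A` is the absorption constant of the «budgets add» format
([Balaban1989LargeFieldII] (1.69) p. 377 — CONTEXT, the printed `O(1)`; never a hypothesis-free fact here), `N₀` the collared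
positional multiplicity of row S4, `ρ′` the located strict product of row S3, `β₀`∕`b₁` the dressing size of a renormalised
large-field component ((w5b), displayed), `m`∕`s̄⁰` the source factor and THE NUMBER ((w2-act), displayed).  This file LOCATES
one necessary smallness of the absorption door and decides its arithmetic; it asserts nothing of Bałaban's densities; 0 sorry,
0 citations used as facts, NO `def … : Prop`.  Headline: «L-B's (w5b)-smallness ∧ (w6) ⇐ fanout < 1 ∧ μ₀ ≤ the joint window»,
NEVER «NE1′ proved»; NE1′ is NOT PRINTED and NOT PROVED; 0 binders instantiated on Bałaban's densities; spine PROVED 0∕9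
unchanged.  Rung (B)+1 on ONE finite four-torus — NOT infinite volume, NOT a mass gap, NOT the Clay problem, NOT summit
progress.  HONEST DEPENDENCY: continuum YM on T⁴ ⇐ BetaPertH ∧ nine spine estimates (0/9 proved); BetaPertH ⇐ (D1) ∧ (D4) ∧
CAP+tail; G-an2-4 gates asym, D1 and NE2/3/4.
-/

noncomputable section

namespace Summit.QuantumFields.BalabanUV.T4Continuum.NE1p.DressedAbsorptionWindow

open Finset
open scoped BigOperators
open Literature.MathematicalPhysics.QuantumFieldTheory.Balaban1983to89
open Literature.MathematicalPhysics.QuantumFieldTheory.Balaban1983to89.T4TermFormat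
open Literature.MathematicalPhysics.QuantumFieldTheory.Balaban1983to89.T4TrajectoryComparison
open Summit.QuantumFields.BalabanUV.T4Continuum.T4TrajectoryDensityDressed
open Summit.QuantumFields.BalabanUV.T4Continuum.NE1p.DressedRoot
open Summit.QuantumFields.BalabanUV.T4Continuum.NE1p.DressedBirthSuppliers
open Summit.QuantumFields.BalabanUV.T4Continuum.NE1p.DressedUniformConstants

/-! ## §1 The fan-out number and the necessity of `fanout < 1` (the wall's falsifier W5-C) -/

/-- **THE FAN-OUT NUMBER** [shape]: `fanout A N₀ ρ′ = A·N₀·(1−ρ′)⁻¹` — absorption constant × positional multiplicity of the live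
older families × the geometric age sum of their classes.  A number; nothing asserted. [folklore] -/
def fanout (A N₀ ρ' : ℝ) : ℝ := A * N₀ * (1 - ρ')⁻¹

/-- `fanout ≥ 0` for `A, N₀ ≥ 0`, `ρ′ < 1`. [arith] [folklore] -/
theorem fanout_nonneg {A N₀ ρ' : ℝ} (hA : 0 ≤ A) (hN₀ : 0 ≤ N₀) (hρ' : ρ' < 1) : 0 ≤ fanout A N₀ ρ' := by
  unfold fanout
  have : 0 ≤ (1 - ρ')⁻¹ := inv_nonneg.mpr (by linarith)
  positivity

/-- The (w5b)-smallness REARRANGED: `β₀ + A·N₀·A₀·(1−ρ′)⁻¹ ≤ A₀ ⟺ β₀ ≤ (1 − fanout A N₀ ρ′)·A₀`. [arith] [folklore] -/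
theorem absorbSmall_iff_le_mul {β₀ A N₀ A₀ ρ' : ℝ} :
    β₀ + A * N₀ * A₀ * (1 - ρ')⁻¹ ≤ A₀ ↔ β₀ ≤ (1 - fanout A N₀ ρ') * A₀ := by
  unfold fanout
  constructor <;> intro h <;> nlinarith [h]

/-- **NECESSITY (W5-C as a kernel fact)**: if the dressing size is POSITIVE (`0 < β₀`) and some amplitude `A₀ ≥ 0` satisfies the
(w5b)-smallness `β₀ + A·N₀·A₀·(1−ρ′)⁻¹ ≤ A₀`, then `fanout A N₀ ρ′ < 1`.  Contrapositive: once the absorption constant times the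
fan-out times the age sum reaches `1`, NO class amplitude closes the absorption door. [arith] [folklore] -/
theorem fanout_lt_one_of_absorbSmall {β₀ A N₀ A₀ ρ' : ℝ} (hβ₀ : 0 < β₀) (hA₀ : 0 ≤ A₀)
    (h : β₀ + A * N₀ * A₀ * (1 - ρ')⁻¹ ≤ A₀) : fanout A N₀ ρ' < 1 := by
  have h' : β₀ ≤ (1 - fanout A N₀ ρ') * A₀ := absorbSmall_iff_le_mul.mp h
  by_contra hge
  have hge' : 1 ≤ fanout A N₀ ρ' := not_lt.mp hge
  have : (1 - fanout A N₀ ρ') * A₀ ≤ 0 := mul_nonpos_of_nonpos_of_nonneg (by linarith) hA₀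
  linarith

/-- With no room (`fanout A N₀ ρ′ = 1`) the (w5b)-smallness forces `β₀ ≤ 0`: a renormalised component whose absorption fan-out
exactly saturates cannot carry any dressing of its own. [arith] [folklore] -/
theorem dressing_nonpos_of_fanout_eq_one {β₀ A N₀ A₀ ρ' : ℝ} (hf : fanout A N₀ ρ' = 1)
    (h : β₀ + A * N₀ * A₀ * (1 - ρ')⁻¹ ≤ A₀) : β₀ ≤ 0 := by
  have h' := absorbSmall_iff_le_mul.mp h
  rw [hf, sub_self, zero_mul] at h'
  exact h'

/-! ## §2 Sufficiency: the amplitude fixed point -/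

/-- **THE AMPLITUDE FIXED POINT** [shape]: `absorbAmplitude β₀ A N₀ ρ′ = β₀ ∕ (1 − fanout A N₀ ρ′)` — the least class amplitude
closing the absorption door (equality in the (w5b)-smallness).  A number; nothing asserted. [folklore] -/
def absorbAmplitude (β₀ A N₀ ρ' : ℝ) : ℝ := β₀ / (1 - fanout A N₀ ρ')

/-- For `fanout < 1`: the (w5b)-smallness holds at `A₀` IFF `absorbAmplitude ≤ A₀`. [arith] [folklore] -/
theorem absorbSmall_iff {β₀ A N₀ A₀ ρ' : ℝ} (hf : fanout A N₀ ρ' < 1) :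
    β₀ + A * N₀ * A₀ * (1 - ρ')⁻¹ ≤ A₀ ↔ absorbAmplitude β₀ A N₀ ρ' ≤ A₀ := by
  rw [absorbSmall_iff_le_mul, absorbAmplitude, div_le_iff₀ (by linarith), mul_comm]

/-- **SUFFICIENCY**: for `fanout < 1`, every amplitude `A₀ ≥ absorbAmplitude β₀ A N₀ ρ′` satisfies the (w5b)-smallness — the
hypothesis `hsmall` of `DressedBirthSuppliers.hbirth_of_absorbsFrom_live` (with `M₀ = N₀`) resp. `hbirth_of_absorbsFrom`
(read `N₀ := M₀`) VERBATIM. [arith] [folklore] -/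
theorem absorbSmall_of_le {β₀ A N₀ A₀ ρ' : ℝ} (hf : fanout A N₀ ρ' < 1) (hA₀ : absorbAmplitude β₀ A N₀ ρ' ≤ A₀) :
    β₀ + A * N₀ * A₀ * (1 - ρ')⁻¹ ≤ A₀ :=
  (absorbSmall_iff hf).mpr hA₀

/-- The fixed point itself closes the door (equality case). [arith] [folklore] -/
theorem absorbSmall_absorbAmplitude {β₀ A N₀ ρ' : ℝ} (hf : fanout A N₀ ρ' < 1) :
    β₀ + A * N₀ * absorbAmplitude β₀ A N₀ ρ' * (1 - ρ')⁻¹ ≤ absorbAmplitude β₀ A N₀ ρ' :=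
  absorbSmall_of_le hf le_rfl

/-- The fixed point is nonnegative for a nonnegative dressing size (`fanout < 1`). [arith] [folklore] -/
theorem absorbAmplitude_nonneg {β₀ A N₀ ρ' : ℝ} (hβ₀ : 0 ≤ β₀) (hf : fanout A N₀ ρ' < 1) :
    0 ≤ absorbAmplitude β₀ A N₀ ρ' :=
  div_nonneg hβ₀ (by linarith)

/-- The fixed point dominates the bare dressing size (`β₀ ≥ 0`, `0 ≤ fanout < 1`): absorption never lowers the amplitude.
[arith] [folklore] -/
theorem le_absorbAmplitude {β₀ A N₀ ρ' : ℝ} (hβ₀ : 0 ≤ β₀) (hf0 : 0 ≤ fanout A N₀ ρ') (hf : fanout A N₀ ρ' < 1) :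
    β₀ ≤ absorbAmplitude β₀ A N₀ ρ' := by
  rw [absorbAmplitude, le_div_iff₀ (by linarith)]
  nlinarith

/-- History-free case: with nothing absorbed (`A = 0` or `N₀ = 0`) the fixed point is the dressing size itself. [arith] [folklore] -/
theorem absorbAmplitude_of_fanout_zero {β₀ A N₀ ρ' : ℝ} (hf : fanout A N₀ ρ' = 0) :
    absorbAmplitude β₀ A N₀ ρ' = β₀ := by
  rw [absorbAmplitude, hf, sub_zero, div_one]

/-! ## §3 The joint source window: (w6) ∧ (w5b)-smallness together -/

/-- **LINEARITY IN THE SOURCE STRENGTH**: a dressing size `β₀ = b₁·μ₀` proportional to the source window radius gives the fixed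
point `absorbAmplitude (b₁·μ₀) A N₀ ρ′ = a₁·μ₀` with the amplitude per unit source `a₁ = b₁ ∕ (1 − fanout A N₀ ρ′)` — the shape
`A₀ = a₁·μ₀` in which row S3's source window `muWindow` is stated. [arith] [folklore] -/
theorem absorbAmplitude_linear (b₁ μ₀ A N₀ ρ' : ℝ) :
    absorbAmplitude (b₁ * μ₀) A N₀ ρ' = b₁ / (1 - fanout A N₀ ρ') * μ₀ := by
  rw [absorbAmplitude]
  ring

/-- **THE JOINT WINDOW** [bookkeeping]: `fanout A N₀ ρ′ < 1`, dressing per unit source `b₁` with `0 < m·N₀·(b₁∕(1 − fanout))`,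
`ρ′ < 1`, and a window radius `μ₀ ≤ muWindow s̄⁰ ρ′ m N₀ (b₁∕(1 − fanout))` ⟹ at the amplitude `A₀ := absorbAmplitude (b₁μ₀) A N₀ ρ′`
BOTH the (w6) smallness `m·(N₀·A₀·(1−ρ′)⁻¹) ≤ 1 − s̄⁰` (`UniformConstants.hsmall`, by S3's `hsmall_of_le_muWindow` BY NAME) AND the
(w5b)-smallness `b₁μ₀ + A·N₀·A₀·(1−ρ′)⁻¹ ≤ A₀` hold.  Read: the two doors compete for the same `N₀(1−ρ′)⁻¹`; the joint region
is `fanout < 1 ∧ μ₀ ≤ (1−s̄⁰)(1−ρ′)(1−fanout)∕(m·N₀·b₁)`. [folklore] -/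
theorem jointWindow {b₁ μ₀ A N₀ ρ' m sbar : ℝ} (hf : fanout A N₀ ρ' < 1)
    (hpos : 0 < m * N₀ * (b₁ / (1 - fanout A N₀ ρ'))) (hρ' : ρ' < 1)
    (hμ₀ : μ₀ ≤ muWindow sbar ρ' m N₀ (b₁ / (1 - fanout A N₀ ρ'))) :
    m * (N₀ * absorbAmplitude (b₁ * μ₀) A N₀ ρ' * (1 - ρ')⁻¹) ≤ 1 - sbar ∧
      b₁ * μ₀ + A * N₀ * absorbAmplitude (b₁ * μ₀) A N₀ ρ' * (1 - ρ')⁻¹ ≤ absorbAmplitude (b₁ * μ₀) A N₀ ρ' := by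
  refine ⟨?_, absorbSmall_absorbAmplitude hf⟩
  rw [absorbAmplitude_linear]
  exact hsmall_of_le_muWindow hpos hρ' hμ₀

/-- The joint window is monotone in the amplitude slack: any `A₀` between the fixed point and the (w6) ceiling works for both
doors — `absorbAmplitude ≤ A₀` gives (w5b), `m·(N₀·A₀·(1−ρ′)⁻¹) ≤ 1 − s̄⁰` is (w6) itself; the interval is non-empty iff the fixed
point obeys (w6). [bookkeeping] [folklore] -/
theorem jointWindow_interval {β₀ A N₀ ρ' m sbar A₀ : ℝ} (hf : fanout A N₀ ρ' < 1)
    (hlo : absorbAmplitude β₀ A N₀ ρ' ≤ A₀) (hhi : m * (N₀ * A₀ * (1 - ρ')⁻¹) ≤ 1 - sbar) :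
    (β₀ + A * N₀ * A₀ * (1 - ρ')⁻¹ ≤ A₀) ∧ m * (N₀ * A₀ * (1 - ρ')⁻¹) ≤ 1 - sbar :=
  ⟨absorbSmall_of_le hf hlo, hhi⟩

/-! ## §4 The composed supplier: S5's live-family door at S3's cell constants, `hsmall` discharged -/

variable {Bk : T4TermFormat.Booking}

/-- **LEAF L-B FROM (w5b), LIVE-FAMILY FORM, AT THE CELL CONSTANTS — `BookingLeaves.hbirth` VERBATIM with the (w5b)-smallness
DISCHARGED** [bookkeeping]: take row S3's `U := uniformConstantsCell L C c̄ κ N₀ A₀ m s̄⁰ ρ′ …` (so `U.N₀ = N₀`, `U.A₀ = A₀`,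
`U.ρ′ = ρ′`, `U.Λ = L⁴`, `U.τ = L⁻³`); absorbed families strictly older and among the live families of the met component at the
birth scale, counted by the leaf's own positional count `N₀·(L⁴)^{k−j}` (row S4's currency); absorption under the dressed gate
(`AbsorbsFrom … (budgetGate …)`); dressing sizes `β j ≤ β₀·(L⁻³)^{K−j}`; and, in place of S5's `hsmall`, the two located numbers
`fanout A N₀ ρ′ < 1` (W5-C) and `absorbAmplitude β₀ A N₀ ρ′ ≤ A₀` ⟹ `hbirth` (`DressedBirthSuppliers.hbirth_of_absorbsFrom_live` BY
NAME).  «Absorption constant `A` at mergers, fan-out below one» — nothing else; the (w5b) sizes `β`, `A` stay displayed binders.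
[folklore] -/
theorem hbirth_of_absorbsFrom_live_cell {L C cbar κ N₀ A₀ m sbar ρ' : ℝ} (hL : 1 ≤ L) (hC : 0 ≤ C) (hcbar : 0 ≤ cbar)
    (hκ : 0 ≤ κ) (hN₀ : 0 ≤ N₀) (hA₀ : 0 ≤ A₀) (hm : 0 ≤ m) (hloc : locCell L C cbar κ ≤ ρ') (hρ'1 : ρ' < 1)
    (hsmall : m * (N₀ * A₀ * (1 - ρ')⁻¹) ≤ 1 - sbar) (T : Trajectory Bk) (ρ : ℕ → ℝ) (s₀ : Bk.Birth → ℕ → ℝ)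
    (S : ℕ → Bk.Birth → Finset Bk.Birth) {Sabs : Bk.Birth → Finset Bk.Birth} {β : ℕ → ℝ} {A β₀ : ℝ}
    (holder : ∀ b b₀, b₀ ∈ Sabs b → Bk.birthScale b₀ < Bk.birthScale b) (hsub : ∀ b, Sabs b ⊆ S (Bk.birthScale b) b)
    (hcountS : ∀ k b, ∀ j ≤ k, (((S k b).filter fun f => Bk.birthScale f = j).card : ℝ) ≤ N₀ * (L ^ 4) ^ (k - j))
    (hA : 0 ≤ A)
    (habs : T.AbsorbsFrom C ρ β A Sabs
      (budgetGate T s₀ m S C ρ))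
    (hβ : ∀ j, j ≤ Bk.K → β j ≤ β₀ * (L⁻¹ ^ 3) ^ (Bk.K - j))
    (hfan : fanout A N₀ ρ' < 1) (hamp : absorbAmplitude β₀ A N₀ ρ' ≤ A₀) :
    T.BirthsFromOld (uniformConstantsCell L C cbar κ N₀ A₀ m sbar ρ' hL hC hcbar hκ hN₀ hA₀ hm hloc hρ'1 hsmall).C ρ
      (twoRate (uniformConstantsCell L C cbar κ N₀ A₀ m sbar ρ' hL hC hcbar hκ hN₀ hA₀ hm hloc hρ'1 hsmall).A₀
        (uniformConstantsCell L C cbar κ N₀ A₀ m sbar ρ' hL hC hcbar hκ hN₀ hA₀ hm hloc hρ'1 hsmall).ρ₁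
        (uniformConstantsCell L C cbar κ N₀ A₀ m sbar ρ' hL hC hcbar hκ hN₀ hA₀ hm hloc hρ'1 hsmall).τ Bk.K)
      (budgetGate T s₀ (uniformConstantsCell L C cbar κ N₀ A₀ m sbar ρ' hL hC hcbar hκ hN₀ hA₀ hm hloc hρ'1 hsmall).m S
        (uniformConstantsCell L C cbar κ N₀ A₀ m sbar ρ' hL hC hcbar hκ hN₀ hA₀ hm hloc hρ'1 hsmall).C ρ) :=
  hbirth_of_absorbsFrom_live (uniformConstantsCell L C cbar κ N₀ A₀ m sbar ρ' hL hC hcbar hκ hN₀ hA₀ hm hloc hρ'1 hsmall) T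
    ρ s₀ S holder hsub (by simpa using hcountS) hA (by simpa using habs) (by simpa using hβ)
    (by simpa using absorbSmall_of_le hfan hamp)

/-! ## §5 Decided numerals: the joint region is non-empty (non-vacuity of the arithmetic only) -/

/-- `A = 1∕4`, `N₀ = 1`, `ρ′ = 1∕2`: `fanout = 1∕2`. [decided toy] [folklore] -/
theorem fanout_quarter : fanout (1 / 4) 1 (1 / 2) = 1 / 2 := by
  norm_num [fanout]

/-- … and the fixed point of a unit dressing is `2`. [decided toy] [folklore] -/
theorem absorbAmplitude_quarter : absorbAmplitude 1 (1 / 4) 1 (1 / 2) = 2 := by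
  rw [absorbAmplitude, fanout_quarter]
  norm_num

/-- … so `A₀ = 2` closes the absorption door (`1 + (1∕4)·1·2·2 = 2 ≤ 2`) while, with `m = 1∕8`, the (w6) window
`(1∕8)·(1·2·2) = 1∕2 ≤ 1 − s̄⁰` admits every action margin `s̄⁰ ≤ 1∕2`: both doors open at once. [decided toy] [folklore] -/
example : (1 + (1 / 4 : ℝ) * 1 * 2 * (1 - 1 / 2)⁻¹ ≤ 2) ∧ (1 / 8 : ℝ) * (1 * 2 * (1 - 1 / 2)⁻¹) ≤ 1 - 1 / 2 :=
  jointWindow_interval (β₀ := 1) (A := 1 / 4) (N₀ := 1) (ρ' := 1 / 2) (m := 1 / 8) (sbar := 1 / 2) (A₀ := 2)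
    (by rw [fanout_quarter]; norm_num) (by rw [absorbAmplitude_quarter]) (by norm_num)

end Summit.QuantumFields.BalabanUV.T4Continuum.NE1p.DressedAbsorptionWindow

end
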